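import Mathlib
import Summits.Ventures.HodgeRepro.Tier4.Common.AutForms

/-!
# Tier4/Common/ConcreteForms — the concrete form space of `X_{Γ′}` over a domain `D`: bounded measurable invariant
forms, the `L²(D)` pairing, and the `FormAlgebra` instance modulo the two textbook residuals

Blind re-derivation cell `pub-hodge-repro`, Tier 4 (README §9–§10), seat t4-typer-1 (gen 0).  Target tree path
`lean/Summits/Ventures/HodgeRepro/Tier4/Common/ConcreteForms.lean`.  Imports `Tier4/Common/AutForms.lean`
(typer-1: `IsAutForm1/2`, `wedgeField`, `pairing2`, the ball) and, through it, `TargetData` and typer-2's calculus.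

WHAT IS DEFINED.  `IsBddMeasOn D f`: `f` is a.e.-strongly-measurable and bounded on `D` (so that all the
products the `L²(D)` pairing integrates are integrable: `D ⊆ 𝔹²` has finite Lebesgue measure).  The CONCRETE FORM
SPACE `d.concreteForms Γ' D`: the ℂ-submodule of pairs `(F, h)` — a `1`-form `F` of `X_{Γ′}` and a `2`-form
coefficient `h` of `X_{Γ′}` (`IsAutForm1`, `IsAutForm2`), both bounded measurable on `D`.  On it the wedge
`(F, h) ∧ (G, k) := (0, F ∧ G)` (pointwise, the sealed `wedge`), the pairing
`⟨(F, h), (G, k)⟩ := ∫_D Σ_i F_i conj G_i + ∫_D h conj k` (the target's own `2`-form integrand on the second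
component, the Euclidean one on the first — the first never enters (P)), `H10 = {h = 0}`, `H20 = {F = 0}`.

WHAT IS PROVED.  Closure of the submodule; integrability of the products (`integrableOn_mul_conj`,
`integrableOn_inner`); the wedge of two concrete forms is a concrete form (`wedgeField_isBddMeasOn`); the pairing
is sesquilinear (`pairingC`), hermitian (`pairingC_conj`), degree-orthogonal; `wedge` alternating; and
**`concreteFormAlgebra`**: the `FormAlgebra` of `Tier4/Common/Forms.lean` on `d.concreteForms Γ' D` given the TWO
textbook residuals as explicit hypotheses — (T1) `hpos`: positive definiteness of the pairing on the concrete forms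
(`∫_D ‖F‖² + ∫_D |h|² > 0` for a non-zero invariant form: the vanishing a.e. on the fundamental domain spreads to
the ball through the invariance and continuity), (T2) `hfin`: finite-dimensionality of the concrete forms
(Cartan–Serre on the compact `X_{Γ′}`).  Nothing else is assumed.

Nothing here says anything about the status of the Hodge conjecture for CM abelian varieties, which is NOT proved
(HC_CM is NOT proved by anyone in this repository).
-/

set_option autoImplicit false

noncomputable section

open Matrix MeasureTheory NumberField
open scoped ComplexConjugate ComplexOrder

namespace Summit.Ventures.HodgeRepro.Tier4

/-! ## Bounded measurable functions on a domain in the ball -/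

/-- `f` is a.e.-strongly-measurable and bounded on `D`. -/
def IsBddMeasOn {β : Type} [NormedAddCommGroup β] (D : Set (Fin 2 → ℂ)) (f : (Fin 2 → ℂ) → β) : Prop :=
  AEStronglyMeasurable f (volume.restrict D) ∧ ∃ C : ℝ, ∀ z ∈ D, ‖f z‖ ≤ C

namespace IsBddMeasOn

variable {β : Type} [NormedAddCommGroup β] {D : Set (Fin 2 → ℂ)}

/-- Sums. -/
theorem add {f g : (Fin 2 → ℂ) → β} (hf : IsBddMeasOn D f) (hg : IsBddMeasOn D g) : IsBddMeasOn D (f + g) := by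
  obtain ⟨hfm, C, hC⟩ := hf
  obtain ⟨hgm, C', hC'⟩ := hg
  refine ⟨hfm.add hgm, C + C', fun z hz => ?_⟩
  calc ‖(f + g) z‖ = ‖f z + g z‖ := rfl
    _ ≤ ‖f z‖ + ‖g z‖ := norm_add_le _ _
    _ ≤ C + C' := add_le_add (hC z hz) (hC' z hz)

/-- The zero function. -/
theorem zero : IsBddMeasOn D (0 : (Fin 2 → ℂ) → β) :=
  ⟨aestronglyMeasurable_const, 0, fun _ _ => by simp⟩

/-- Scalar multiples. -/
theorem smul [NormedSpace ℂ β] (c : ℂ) {f : (Fin 2 → ℂ) → β} (hf : IsBddMeasOn D f) : IsBddMeasOn D (c • f) := by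
  obtain ⟨hfm, C, hC⟩ := hf
  refine ⟨hfm.const_smul c, ‖c‖ * C, fun z hz => ?_⟩
  calc ‖(c • f) z‖ = ‖c‖ * ‖f z‖ := by simp [norm_smul]
    _ ≤ ‖c‖ * C := mul_le_mul_of_nonneg_left (hC z hz) (norm_nonneg c)

end IsBddMeasOn

/-- The ball is bounded. -/
theorem isBounded_ball : Bornology.IsBounded ball := by
  refine (Metric.isBounded_closedBall (x := (0 : Fin 2 → ℂ)) (r := 1)).subset fun z hz => ?_
  simp only [ball, nsq, Set.mem_setOf_eq] at hz
  rw [Metric.mem_closedBall, dist_zero_right, pi_norm_le_iff_of_nonneg zero_le_one]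
  intro i
  have h0 : 0 ≤ ‖z 0‖ ^ 2 := sq_nonneg _
  have h1 : 0 ≤ ‖z 1‖ ^ 2 := sq_nonneg _
  have : ‖z i‖ ^ 2 ≤ 1 := by fin_cases i <;> simp <;> nlinarith
  nlinarith [norm_nonneg (z i)]

/-- A subset of the ball has finite Lebesgue measure. -/
theorem volume_ne_top_of_subset_ball {D : Set (Fin 2 → ℂ)} (hD : D ⊆ ball) : volume D ≠ ⊤ :=
  ((measure_mono hD).trans_lt isBounded_ball.measure_lt_top).ne

/-- The product `f · conj g` of two bounded measurable functions on a measurable `D ⊆ 𝔹²` is integrable on `D`. -/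
theorem integrableOn_mul_conj {D : Set (Fin 2 → ℂ)} (hD : D ⊆ ball) (hDm : MeasurableSet D)
    {f g : (Fin 2 → ℂ) → ℂ} (hf : IsBddMeasOn D f) (hg : IsBddMeasOn D g) :
    IntegrableOn (fun z => f z * conj (g z)) D := by
  obtain ⟨hfm, C, hC⟩ := hf
  obtain ⟨hgm, C', hC'⟩ := hg
  refine ⟨hfm.mul (Complex.continuous_conj.comp_aestronglyMeasurable hgm), ?_⟩
  refine HasFiniteIntegral.restrict_of_bounded (C := |C| * |C'|) (volume_ne_top_of_subset_ball hD).lt_top ?_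
  refine ae_restrict_of_forall_mem hDm fun z hz => ?_
  rw [norm_mul, Complex.norm_conj]
  exact mul_le_mul ((hC z hz).trans (le_abs_self C)) ((hC' z hz).trans (le_abs_self C')) (norm_nonneg _)
    (abs_nonneg C)

/-- The product `f · conj g` is integrable on `D` — the form used by the integral lemmas. -/
theorem integrable_mul_conj_restrict {D : Set (Fin 2 → ℂ)} (hD : D ⊆ ball) (hDm : MeasurableSet D)
    {f g : (Fin 2 → ℂ) → ℂ} (hf : IsBddMeasOn D f) (hg : IsBddMeasOn D g) :
    Integrable (fun z => f z * conj (g z)) (volume.restrict D) :=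
  integrableOn_mul_conj hD hDm hf hg

/-- The components of a bounded measurable vector-valued function are bounded measurable. -/
theorem IsBddMeasOn.apply {D : Set (Fin 2 → ℂ)} {F : (Fin 2 → ℂ) → (Fin 2 → ℂ)} (hF : IsBddMeasOn D F) (i : Fin 2) :
    IsBddMeasOn D fun z => F z i := by
  obtain ⟨hFm, C, hC⟩ := hF
  refine ⟨(continuous_apply i).comp_aestronglyMeasurable hFm, C, fun z hz => ?_⟩
  exact (norm_le_pi_norm (F z) i).trans (hC z hz)

/-- The Euclidean pairing `Σ_i F_i conj G_i` of two bounded measurable fields is integrable on `D`. -/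
theorem integrable_inner_restrict {D : Set (Fin 2 → ℂ)} (hD : D ⊆ ball) (hDm : MeasurableSet D)
    {F G : (Fin 2 → ℂ) → (Fin 2 → ℂ)} (hF : IsBddMeasOn D F) (hG : IsBddMeasOn D G) :
    Integrable (fun z => ∑ i, F z i * conj (G z i)) (volume.restrict D) :=
  integrable_finsetSum _ fun i _ => integrable_mul_conj_restrict hD hDm (hF.apply i) (hG.apply i)

/-- The wedge of two bounded measurable fields is bounded measurable. -/
theorem IsBddMeasOn.wedgeField {D : Set (Fin 2 → ℂ)} {F G : (Fin 2 → ℂ) → (Fin 2 → ℂ)} (hF : IsBddMeasOn D F)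
    (hG : IsBddMeasOn D G) : IsBddMeasOn D (Tier4.wedgeField F G) := by
  obtain ⟨hFm, C, hC⟩ := hF
  obtain ⟨hGm, C', hC'⟩ := hG
  refine ⟨?_, 2 * (|C| * |C'|), fun z hz => ?_⟩
  · have h00 := (continuous_apply (0 : Fin 2)).comp_aestronglyMeasurable hFm
    have h01 := (continuous_apply (1 : Fin 2)).comp_aestronglyMeasurable hFm
    have h10 := (continuous_apply (0 : Fin 2)).comp_aestronglyMeasurable hGm
    have h11 := (continuous_apply (1 : Fin 2)).comp_aestronglyMeasurable hGm
    exact (h00.mul h11).sub (h01.mul h10)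
  · have hFi : ∀ i, ‖F z i‖ ≤ |C| := fun i => (norm_le_pi_norm (F z) i).trans ((hC z hz).trans (le_abs_self C))
    have hGi : ∀ i, ‖G z i‖ ≤ |C'| := fun i => (norm_le_pi_norm (G z) i).trans ((hC' z hz).trans (le_abs_self C'))
    have h1 : ‖F z 0 * G z 1‖ ≤ |C| * |C'| := by
      rw [norm_mul]; exact mul_le_mul (hFi 0) (hGi 1) (norm_nonneg _) (abs_nonneg C)
    have h2 : ‖F z 1 * G z 0‖ ≤ |C| * |C'| := by
      rw [norm_mul]; exact mul_le_mul (hFi 1) (hGi 0) (norm_nonneg _) (abs_nonneg C)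
    calc ‖Tier4.wedgeField F G z‖ = ‖F z 0 * G z 1 - F z 1 * G z 0‖ := rfl
      _ ≤ ‖F z 0 * G z 1‖ + ‖F z 1 * G z 0‖ := norm_sub_le _ _
      _ ≤ |C| * |C'| + |C| * |C'| := add_le_add h1 h2
      _ = 2 * (|C| * |C'|) := by ring

end Summit.Ventures.HodgeRepro.Tier4

/-! ## The pairing and the wedge on pairs `(1-form, 2-form coefficient)` -/

namespace Summit.Ventures.HodgeRepro.Tier4

/-- The space of pairs `(F, h)`: a cotangent field and a `2`-form coefficient. -/
abbrev FormPair : Type := ((Fin 2 → ℂ) → (Fin 2 → ℂ)) × ((Fin 2 → ℂ) → ℂ)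

/-- **The pairing on pairs over `D`**: `⟨(F, h), (G, k)⟩ := ∫_D Σ_i F_i conj G_i + ∫_D h conj k`. -/
def pairingC (D : Set (Fin 2 → ℂ)) (x y : FormPair) : ℂ :=
  (∫ z in D, ∑ i, x.1 z i * conj (y.1 z i)) + pairing2 D x.2 y.2

/-- **The wedge on pairs**: `(F, h) ∧ (G, k) := (0, F ∧ G)`. -/
def wedgeC (x y : FormPair) : FormPair := (0, wedgeField x.1 y.1)

/-- The pairing is hermitian. -/
theorem pairingC_conj (D : Set (Fin 2 → ℂ)) (x y : FormPair) : pairingC D y x = conj (pairingC D x y) := by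
  unfold pairingC
  rw [map_add, ← pairing2_conj, ← integral_conj]
  congr 2
  funext z
  rw [map_sum]
  refine Finset.sum_congr rfl fun i _ => ?_
  simp only [map_mul, Complex.conj_conj]
  ring

/-- The pairing is homogeneous in the first argument. -/
theorem pairingC_smul_left (D : Set (Fin 2 → ℂ)) (c : ℂ) (x y : FormPair) :
    pairingC D (c • x) y = c * pairingC D x y := by
  unfold pairingC
  rw [mul_add, ← pairing2_smul_left]
  congr 1
  · rw [← integral_const_mul]
    congr 1
    funext z
    rw [Finset.mul_sum]
    refine Finset.sum_congr rfl fun i _ => ?_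
    simp only [Prod.smul_fst, Pi.smul_apply, smul_eq_mul]
    ring

/-- The pairing is conjugate-homogeneous in the second argument. -/
theorem pairingC_smul_right (D : Set (Fin 2 → ℂ)) (c : ℂ) (x y : FormPair) :
    pairingC D x (c • y) = conj c * pairingC D x y := by
  rw [pairingC_conj, pairingC_smul_left, map_mul, ← pairingC_conj]

/-- The pairing is additive in the first argument, for bounded measurable pairs on `D ⊆ 𝔹²`. -/
theorem pairingC_add_left {D : Set (Fin 2 → ℂ)} (hD : D ⊆ ball) (hDm : MeasurableSet D) {x x' y : FormPair}
    (hx : IsBddMeasOn D x.1 ∧ IsBddMeasOn D x.2) (hx' : IsBddMeasOn D x'.1 ∧ IsBddMeasOn D x'.2)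
    (hy : IsBddMeasOn D y.1 ∧ IsBddMeasOn D y.2) :
    pairingC D (x + x') y = pairingC D x y + pairingC D x' y := by
  unfold pairingC pairing2
  have h1 : (∫ z in D, ∑ i, (x + x').1 z i * conj (y.1 z i)) =
      (∫ z in D, ∑ i, x.1 z i * conj (y.1 z i)) + ∫ z in D, ∑ i, x'.1 z i * conj (y.1 z i) := by
    rw [← integral_add (integrable_inner_restrict hD hDm hx.1 hy.1) (integrable_inner_restrict hD hDm hx'.1 hy.1)]
    congr 1
    funext z
    rw [← Finset.sum_add_distrib]
    refine Finset.sum_congr rfl fun i _ => ?_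
    simp only [Prod.fst_add, Pi.add_apply]
    ring
  have h2 : (∫ z in D, (x + x').2 z * conj (y.2 z)) =
      (∫ z in D, x.2 z * conj (y.2 z)) + ∫ z in D, x'.2 z * conj (y.2 z) := by
    rw [← integral_add (integrable_mul_conj_restrict hD hDm hx.2 hy.2) (integrable_mul_conj_restrict hD hDm hx'.2 hy.2)]
    congr 1
    funext z
    simp only [Prod.snd_add, Pi.add_apply]
    ring
  rw [h1, h2]
  ring

/-- The pairing is additive in the second argument, for bounded measurable pairs on `D ⊆ 𝔹²`. -/
theorem pairingC_add_right {D : Set (Fin 2 → ℂ)} (hD : D ⊆ ball) (hDm : MeasurableSet D) {x y y' : FormPair}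
    (hx : IsBddMeasOn D x.1 ∧ IsBddMeasOn D x.2) (hy : IsBddMeasOn D y.1 ∧ IsBddMeasOn D y.2)
    (hy' : IsBddMeasOn D y'.1 ∧ IsBddMeasOn D y'.2) :
    pairingC D x (y + y') = pairingC D x y + pairingC D x y' := by
  rw [pairingC_conj, pairingC_add_left hD hDm hy hy' hx, map_add, ← pairingC_conj, ← pairingC_conj]

/-- Pairs of different degrees are orthogonal: `⟨(F, 0), (0, k)⟩ = 0`. -/
theorem pairingC_degree (D : Set (Fin 2 → ℂ)) (F : (Fin 2 → ℂ) → (Fin 2 → ℂ)) (k : (Fin 2 → ℂ) → ℂ) :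
    pairingC D (F, 0) (0, k) = 0 := by
  simp [pairingC, pairing2]

/-- `wedge` on vectors is additive on the left. -/
theorem wedge_add_left (a a' b : Fin 2 → ℂ) : wedge (a + a') b = wedge a b + wedge a' b := by
  simp only [wedge, Pi.add_apply]; ring

/-- `wedge` on vectors is additive on the right. -/
theorem wedge_add_right (a b b' : Fin 2 → ℂ) : wedge a (b + b') = wedge a b + wedge a b' := by
  simp only [wedge, Pi.add_apply]; ring

/-- `wedge` on vectors is homogeneous on the left. -/
theorem wedge_smul_left (c : ℂ) (a b : Fin 2 → ℂ) : wedge (c • a) b = c * wedge a b := by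
  simp only [wedge, Pi.smul_apply, smul_eq_mul]; ring

/-- `wedge` on vectors is homogeneous on the right. -/
theorem wedge_smul_right (c : ℂ) (a b : Fin 2 → ℂ) : wedge a (c • b) = c * wedge a b := by
  simp only [wedge, Pi.smul_apply, smul_eq_mul]; ring

/-- `wedge a a = 0`. -/
theorem wedge_self_vec (a : Fin 2 → ℂ) : wedge a a = 0 := by
  simp only [wedge]; ring

/-- The wedge on pairs is additive on the left. -/
theorem wedgeC_add_left (x x' y : FormPair) : wedgeC (x + x') y = wedgeC x y + wedgeC x' y := by
  simp only [wedgeC, Prod.mk_add_mk, add_zero]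
  congr 1
  funext z
  simp only [wedgeField, Prod.fst_add, Pi.add_apply, wedge_add_left]

/-- The wedge on pairs is additive on the right. -/
theorem wedgeC_add_right (x y y' : FormPair) : wedgeC x (y + y') = wedgeC x y + wedgeC x y' := by
  simp only [wedgeC, Prod.mk_add_mk, add_zero]
  congr 1
  funext z
  simp only [wedgeField, Prod.fst_add, Pi.add_apply, wedge_add_right]

/-- The wedge on pairs is homogeneous on the left. -/
theorem wedgeC_smul_left (c : ℂ) (x y : FormPair) : wedgeC (c • x) y = c • wedgeC x y := by
  simp only [wedgeC, Prod.smul_mk, smul_zero]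
  congr 1
  funext z
  simp only [wedgeField, Prod.smul_fst, Pi.smul_apply, wedge_smul_left, smul_eq_mul]

/-- The wedge on pairs is homogeneous on the right. -/
theorem wedgeC_smul_right (c : ℂ) (x y : FormPair) : wedgeC x (c • y) = c • wedgeC x y := by
  simp only [wedgeC, Prod.smul_mk, smul_zero]
  congr 1
  funext z
  simp only [wedgeField, Prod.smul_fst, Pi.smul_apply, wedge_smul_right, smul_eq_mul]

/-- `wedgeC x x = 0`. -/
theorem wedgeC_self (x : FormPair) : wedgeC x x = 0 := by
  simp only [wedgeC]
  have : wedgeField x.1 x.1 = 0 := by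
    funext z
    simp [wedgeField, wedge_self_vec]
  rw [this]
  rfl

end Summit.Ventures.HodgeRepro.Tier4
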